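import Summits.CriticalPhenomena.PercolationContinuityZ3.Theorems.Transplant.KNCells2ChainPlanar
import HarnessLib

/-!
# Corridor chain, the PLANAR SCHEDULE over the planar cells: the `23K - 3` target steps from `M_x` to `M_y ∩ H_{x,y}` — `3K - 2` rounds
# shrinking the cube along the axis, `3K - 2` across it (both inside `Q_x`), the start step onto the first face, and `17K` advance steps
# (Kozma–Nitzan's Lemma 11) along `H_{x,y}` — with, for every step, the core, the region, the target (= the next core), the route lemma,
# and the containments the kit framework needs (design HOME/prim-bschramm-p2-g2/F8-DESIGN.md §7–§8; Corridor-over-levels)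

builds on p205010 (kernel theorem, internal audit signed; external expert review pending) — nothing in this file uses p205010.
Lane `prim-bschramm`, seat `prim-bschramm-p2`; helper file (`--supports stmt-CriticalPhenomena-4575`).  Pure `Site 2` geometry.

Parameters: the cells `C : PCells` (`r = Ks`, `K ≥ 20`), the neighbourhood radius `R'` (levels + cube size of the kits) and the minimal route
scale `ℓ₀`, with `27 R' ≤ s` and `R' + ℓ₀ ≤ s`.  Step `i ≤ nLast = 2n₁ + 17K` (`n₁ = 3K - 2`) has core `core i = sBox a σ c (α_i) (β_i) (w_i)`
(levels `α_i ≤ σ(t_a - c_a) ≤ β_i`, `|t_b - c_b| ≤ w_i`), region `region i` (`Q`-box for `i ≤ 2n₁`, the slab `{L_i - 2s ≤ level ≤ L_i + s,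
|trans| ≤ 2r}` after) and target `core (i+1)`; `core 0 = {|level|, |trans| ≤ 3r} = M_x`, `core (nLast + 1) ⊆ M_y ∩ H_{x,y}`.
* `core_route` — from every `v` in the `R'`-enlargement of `core i` a square `v + Λ_ℓ ⊆ region i`, `ℓ ≥ ℓ₀`, with a quarter-face in `core (i+1)`;
* `enlarge_core_subset_region`, `core_succ_subset_region`, `region_subset` (`⊆ Q-box ∪ H-slab`), `core_nonempty`, `core_zero`, `core_last_level/width`.
[cite: KozmaNitzan2024, §4 Lemma 11 (pp. 22–23), Lemma 12 (pp. 23–25)]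
-/

noncomputable section

namespace Summit.CriticalPhenomena.PercolationContinuityZ3.Theorems

namespace Transplant

namespace ChainPlanar

open Literature.Probability.Percolation Literature.Probability.LatticeModels
open Literature.Probability.Percolation.KozmaNitzan
open Literature.Probability.Percolation.KozmaNitzan.Cells (oth oth_ne eq_oth_of_ne)

variable (C : PCells) (R' : ℕ)

/-- The number of shrinking rounds in each direction, `3K - 2`. [cite: KozmaNitzan2024, §4 Lemma 12 (pp. 23–25)] -/
def n₁ : ℕ := 3 * C.K - 2

/-- The number of advance steps, `17K`. [cite: KozmaNitzan2024, §4 Lemma 11 (p. 22)] -/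
def nB : ℕ := 17 * C.K

/-- The index of the last step, `2n₁ + 17K`. [folklore] -/
def nLast : ℕ := 2 * n₁ C + nB C

/-- The half-size `q = 2s + n₁ R'` of the small box after the shrinking rounds. [folklore] -/
def q : ℤ := 2 * (C.s : ℤ) + (n₁ C : ℤ) * R'

/-- The width `w₁ = 3q + s + 2R'` of the first face. [folklore] -/
def w₁ : ℤ := 3 * q C R' + C.s + 2 * R'

/-- Lower level of the core of step `i`. [folklore] -/
def coreα (i : ℕ) : ℤ :=
  if i ≤ n₁ C then -(3 * (C.r : ℤ) - (i : ℤ) * C.s)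
  else if i ≤ 2 * n₁ C then -(2 * (C.s : ℤ) + ((i - n₁ C : ℕ) : ℤ) * R')
  else q C R' + ((i - 2 * n₁ C : ℕ) : ℤ) * C.s

/-- Upper level of the core of step `i`. [folklore] -/
def coreβ (i : ℕ) : ℤ :=
  if i ≤ n₁ C then 3 * (C.r : ℤ) - (i : ℤ) * C.s
  else if i ≤ 2 * n₁ C then 2 * (C.s : ℤ) + ((i - n₁ C : ℕ) : ℤ) * R'
  else q C R' + ((i - 2 * n₁ C : ℕ) : ℤ) * C.s

/-- Transverse half-width of the core of step `i`. [folklore] -/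
def coreW (i : ℕ) : ℤ :=
  if i ≤ n₁ C then 3 * (C.r : ℤ) + (i : ℤ) * R'
  else if i ≤ 2 * n₁ C then 3 * (C.r : ℤ) + (n₁ C : ℤ) * R' - ((i - n₁ C : ℕ) : ℤ) * C.s
  else w₁ C R' + ((i - 2 * n₁ C - 1 : ℕ) : ℤ) * R'

/-- **The core of step `i`** (centre `c`, axis `a`, sign `σ`). [cite: KozmaNitzan2024, §4 Lemmas 11–12] -/
def core (a : Fin 2) (σ : ℤ) (c : Site 2) (i : ℕ) : Finset (Site 2) :=
  sBox a σ c (coreα C R' i) (coreβ C R' i) (coreW C R' i)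

/-- **The region of step `i`**: the `Q`-box `{|level|, |trans| ≤ 5r}` during the shrinking and the start, the slab
`{L_i - 2s ≤ level ≤ L_i + s, |trans| ≤ 2r}` during the advance. [cite: KozmaNitzan2024, §4 Lemmas 11–12] -/
def region (a : Fin 2) (σ : ℤ) (c : Site 2) (i : ℕ) : Finset (Site 2) :=
  if i ≤ 2 * n₁ C then sBox a σ c (-(5 * (C.r : ℤ))) (5 * C.r) (5 * C.r)
  else sBox a σ c (coreα C R' i - 2 * C.s) (coreα C R' i + C.s) (2 * C.r)

/-! ## The parameters of each phase -/

section Phases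

variable {C R'}

/-- Core of a shrink-along round `i ≤ n₁`. [folklore] -/
theorem core_AL {i : ℕ} (hi : i ≤ n₁ C) :
    coreα C R' i = -(3 * (C.r : ℤ) - (i : ℤ) * C.s) ∧ coreβ C R' i = 3 * (C.r : ℤ) - (i : ℤ) * C.s ∧
      coreW C R' i = 3 * (C.r : ℤ) + (i : ℤ) * R' := by
  refine ⟨?_, ?_, ?_⟩
  · unfold coreα; rw [if_pos hi]
  · unfold coreβ; rw [if_pos hi]
  · unfold coreW; rw [if_pos hi]

/-- Core of a shrink-across round `i = n₁ + m`, `m ≤ n₁` (at `m = 0` it is the last shrink-along core). [folklore] -/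
theorem core_AT (hR : 27 * R' ≤ C.s) {i m : ℕ} (him : i = n₁ C + m) (hm : m ≤ n₁ C) :
    coreα C R' i = -(2 * (C.s : ℤ) + (m : ℤ) * R') ∧ coreβ C R' i = 2 * (C.s : ℤ) + (m : ℤ) * R' ∧
      coreW C R' i = 3 * (C.r : ℤ) + (n₁ C : ℤ) * R' - (m : ℤ) * C.s := by
  have hK := C.hK
  have h3r : 3 * (C.r : ℤ) = ((n₁ C : ℤ) + 2) * C.s := by
    have h : n₁ C + 2 = 3 * C.K := by unfold n₁; omega
    have : (3 * C.r : ℤ) = (3 * C.K : ℕ) * (C.s : ℤ) := by push_cast; unfold PCells.r; push_cast; ring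
    rw [this, ← h]; push_cast; ring
  have _ := hR
  by_cases h0 : i ≤ n₁ C
  · have hm0 : m = 0 := by omega
    have hi : i = n₁ C := by omega
    subst hm0
    refine ⟨?_, ?_, ?_⟩
    · unfold coreα; rw [if_pos h0, hi]; push_cast; linarith
    · unfold coreβ; rw [if_pos h0, hi]; push_cast; linarith
    · unfold coreW; rw [if_pos h0, hi]; push_cast; ring
  · have h2 : i ≤ 2 * n₁ C := by omega
    have e : i - n₁ C = m := by omega
    refine ⟨?_, ?_, ?_⟩
    · unfold coreα; rw [if_neg h0, if_pos h2, e]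
    · unfold coreβ; rw [if_neg h0, if_pos h2, e]
    · unfold coreW; rw [if_neg h0, if_pos h2, e]

/-- Core of the face `j ≥ 1` of the advance, `i = 2n₁ + j`. [folklore] -/
theorem core_B {i j : ℕ} (hij : i = 2 * n₁ C + j) (hj : 1 ≤ j) :
    coreα C R' i = q C R' + (j : ℤ) * C.s ∧ coreβ C R' i = q C R' + (j : ℤ) * C.s ∧
      coreW C R' i = w₁ C R' + ((j : ℤ) - 1) * R' := by
  have h0 : ¬(i ≤ n₁ C) := by omega
  have h2 : ¬(i ≤ 2 * n₁ C) := by omega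
  have e : i - 2 * n₁ C = j := by omega
  have e' : ((i - 2 * n₁ C - 1 : ℕ) : ℤ) = (j : ℤ) - 1 := by
    rw [show i - 2 * n₁ C - 1 = j - 1 by omega]; push_cast [hj]; ring
  refine ⟨?_, ?_, ?_⟩
  · unfold coreα; rw [if_neg h0, if_neg h2, e]
  · unfold coreβ; rw [if_neg h0, if_neg h2, e]
  · unfold coreW; rw [if_neg h0, if_neg h2, e']

/-- The region during the shrinking and the start. [folklore] -/
theorem region_A {a : Fin 2} {σ : ℤ} {c : Site 2} {i : ℕ} (hi : i ≤ 2 * n₁ C) :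
    region C R' a σ c i = sBox a σ c (-(5 * (C.r : ℤ))) (5 * C.r) (5 * C.r) := by
  unfold region; rw [if_pos hi]

/-- The region during the advance. [folklore] -/
theorem region_B {a : Fin 2} {σ : ℤ} {c : Site 2} {i j : ℕ} (hij : i = 2 * n₁ C + j) (hj : 1 ≤ j) :
    region C R' a σ c i = sBox a σ c (q C R' + (j : ℤ) * C.s - 2 * C.s) (q C R' + (j : ℤ) * C.s + C.s) (2 * C.r) := by
  have h2 : ¬(i ≤ 2 * n₁ C) := by omega
  unfold region; rw [if_neg h2, (core_B (C := C) (R' := R') hij hj).1]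

end Phases

/-! ## Arithmetic of the parameters -/

section Arith

variable {C R'} (hR : 27 * R' ≤ C.s)
include hR

/-- `3r = n₁ s + 2 s`. [folklore] -/
theorem three_r_eq : 3 * (C.r : ℤ) = (n₁ C : ℤ) * C.s + 2 * C.s := by
  have hK := C.hK
  have _ := hR
  have h : n₁ C + 2 = 3 * C.K := by unfold n₁; omega
  have : (3 * C.r : ℤ) = (3 * C.K : ℕ) * (C.s : ℤ) := by push_cast; unfold PCells.r; push_cast; ring
  rw [this, ← h]; push_cast; ring

/-- `9 n₁ R' ≤ r`. [folklore] -/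
theorem n₁_mul_le : 9 * ((n₁ C : ℤ) * R') ≤ C.r := by
  have hK := C.hK
  have h1 : (n₁ C : ℤ) ≤ 3 * C.K := by have : n₁ C ≤ 3 * C.K := by unfold n₁; omega
                                       exact_mod_cast this
  have h2 : 27 * (R' : ℤ) ≤ C.s := by exact_mod_cast hR
  have hr : (C.r : ℤ) = (C.K : ℤ) * C.s := by unfold PCells.r; push_cast; ring
  rw [hr]
  have hK0 : (0 : ℤ) ≤ C.K := by positivity
  have hR0 : (0 : ℤ) ≤ R' := by positivity
  nlinarith

/-- `27 nB R' ≤ 17 r`. [folklore] -/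
theorem nB_mul_le : 27 * ((nB C : ℤ) * R') ≤ 17 * C.r := by
  have h2 : 27 * (R' : ℤ) ≤ C.s := by exact_mod_cast hR
  have hr : (C.r : ℤ) = (C.K : ℤ) * C.s := by unfold PCells.r; push_cast; ring
  rw [hr]; unfold nB; push_cast
  have hK0 : (0 : ℤ) ≤ C.K := by positivity
  nlinarith

end Arith

/-! ## The route lemma of every step -/

section Route

variable {C R'} {a : Fin 2} {σ : ℤ} (hσ : σ = 1 ∨ σ = -1) (c : Site 2) {ℓ₀ : ℕ} (hR : 27 * R' ≤ C.s) (hℓ : R' + ℓ₀ ≤ C.s)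
include hσ hR hℓ

/-- Routes of the shrink-along rounds `i < n₁`. [cite: KozmaNitzan2024, §4 Lemma 12 (pp. 23–25)] -/
theorem core_route_AL {i : ℕ} (hi : i < n₁ C) {v : Site 2}
    (hv : v ∈ sBox a σ c (coreα C R' i - R') (coreβ C R' i + R') (coreW C R' i + R')) :
    ∃ ℓ : ℕ, ℓ₀ ≤ ℓ ∧ shiftF v (box 2 ℓ) ⊆ region C R' a σ c i ∧
      ∃ (a' : Fin 2) (τ : Fin 2 → ℤˣ), shiftF v (orthantFace a' τ ℓ) ⊆ core C R' a σ c (i + 1) := by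
  have h3r := three_r_eq (C := C) (R' := R') hR
  have hn₁ := n₁_mul_le (C := C) (R' := R') hR
  have h20 : 20 * (C.s : ℤ) ≤ C.r := by exact_mod_cast C.twenty_mul_s_le_r
  have hR' : 27 * (R' : ℤ) ≤ C.s := by exact_mod_cast hR
  have hℓ' : (R' : ℤ) + ℓ₀ ≤ C.s := by exact_mod_cast hℓ
  obtain ⟨eα, eβ, eW⟩ := core_AL (C := C) (R' := R') hi.le
  obtain ⟨eα', eβ', eW'⟩ := core_AL (C := C) (R' := R') (i := i + 1) hi
  have his : ((i : ℤ) + 1) * C.s ≤ (n₁ C : ℤ) * C.s :=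
    mul_le_mul_of_nonneg_right (by exact_mod_cast (show i + 1 ≤ n₁ C from hi)) (by positivity)
  have hiR : (i : ℤ) * R' ≤ (n₁ C : ℤ) * R' := mul_le_mul_of_nonneg_right (by exact_mod_cast hi.le) (by positivity)
  have hi0 : (0 : ℤ) ≤ (i : ℤ) * C.s := by positivity
  have hiR0 : (0 : ℤ) ≤ (i : ℤ) * R' := by positivity
  have hs0 : (0 : ℤ) ≤ C.s := by positivity
  rw [eα, eβ, eW] at hv
  obtain ⟨ℓ, hℓ0, -, hsq, τ, hface⟩ := route_shrinkLong hσ c (u := 3 * (C.r : ℤ) - (i : ℤ) * C.s)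
    (u' := 3 * (C.r : ℤ) - ((i : ℤ) + 1) * C.s) (w := 3 * (C.r : ℤ) + (i : ℤ) * R') (Δ := C.s) (ρ := 5 * C.r) (R' := R') (ℓ₀ := ℓ₀)
    (by ring) (by linarith) hs0 (by linarith) (by linarith) (by linarith) hv
  refine ⟨ℓ, hℓ0, by rw [region_A (by omega)]; exact hsq, a, τ, ?_⟩
  rw [core, eα', eβ', eW']
  convert hface using 2 <;> push_cast <;> ring

/-- Routes of the shrink-across rounds `n₁ ≤ i < 2n₁`. [cite: KozmaNitzan2024, §4 Lemma 12 (pp. 23–25)] -/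
theorem core_route_AT {i : ℕ} (h1 : n₁ C ≤ i) (h2 : i < 2 * n₁ C) {v : Site 2}
    (hv : v ∈ sBox a σ c (coreα C R' i - R') (coreβ C R' i + R') (coreW C R' i + R')) :
    ∃ ℓ : ℕ, ℓ₀ ≤ ℓ ∧ shiftF v (box 2 ℓ) ⊆ region C R' a σ c i ∧
      ∃ (a' : Fin 2) (τ : Fin 2 → ℤˣ), shiftF v (orthantFace a' τ ℓ) ⊆ core C R' a σ c (i + 1) := by
  have h3r := three_r_eq (C := C) (R' := R') hR
  have hn₁ := n₁_mul_le (C := C) (R' := R') hR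
  have h20 : 20 * (C.s : ℤ) ≤ C.r := by exact_mod_cast C.twenty_mul_s_le_r
  have hR' : 27 * (R' : ℤ) ≤ C.s := by exact_mod_cast hR
  have hℓ' : (R' : ℤ) + ℓ₀ ≤ C.s := by exact_mod_cast hℓ
  set m : ℕ := i - n₁ C with hm
  have him : i = n₁ C + m := by omega
  have hm1 : m + 1 ≤ n₁ C := by omega
  obtain ⟨eα, eβ, eW⟩ := core_AT (C := C) (R' := R') hR him (by omega)
  obtain ⟨eα', eβ', eW'⟩ := core_AT (C := C) (R' := R') hR (i := i + 1) (m := m + 1) (by omega) hm1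
  have hms : ((m : ℤ) + 1) * C.s ≤ (n₁ C : ℤ) * C.s := mul_le_mul_of_nonneg_right (by exact_mod_cast hm1) (by positivity)
  have hmR : (m : ℤ) * R' ≤ (n₁ C : ℤ) * R' :=
    mul_le_mul_of_nonneg_right (by exact_mod_cast (show m ≤ n₁ C by omega)) (by positivity)
  have hm0 : (0 : ℤ) ≤ (m : ℤ) * C.s := by positivity
  have hmR0 : (0 : ℤ) ≤ (m : ℤ) * R' := by positivity
  have hs0 : (0 : ℤ) ≤ C.s := by positivity
  rw [eα, eβ, eW] at hv
  obtain ⟨ℓ, hℓ0, -, hsq, τ, hface⟩ := route_shrinkTrans hσ c (u := 2 * (C.s : ℤ) + (m : ℤ) * R')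
    (w := 3 * (C.r : ℤ) + (n₁ C : ℤ) * R' - (m : ℤ) * C.s) (w' := 3 * (C.r : ℤ) + (n₁ C : ℤ) * R' - ((m : ℤ) + 1) * C.s)
    (Δ := C.s) (ρ := 5 * C.r) (R' := R') (ℓ₀ := ℓ₀)
    (by ring) (by linarith) hs0 (by linarith) (by linarith) (by linarith) hv
  refine ⟨ℓ, hℓ0, by rw [region_A h2.le]; exact hsq, oth a, τ, ?_⟩
  rw [core, eα', eβ', eW']
  convert hface using 2 <;> push_cast <;> ring

/-- Route of the start step `i = 2n₁`. [cite: KozmaNitzan2024, §4 Lemmas 11–12] -/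
theorem core_route_start {v : Site 2}
    (hv : v ∈ sBox a σ c (coreα C R' (2 * n₁ C) - R') (coreβ C R' (2 * n₁ C) + R') (coreW C R' (2 * n₁ C) + R')) :
    ∃ ℓ : ℕ, ℓ₀ ≤ ℓ ∧ shiftF v (box 2 ℓ) ⊆ region C R' a σ c (2 * n₁ C) ∧
      ∃ (a' : Fin 2) (τ : Fin 2 → ℤˣ), shiftF v (orthantFace a' τ ℓ) ⊆ core C R' a σ c (2 * n₁ C + 1) := by
  have h3r := three_r_eq (C := C) (R' := R') hR
  have hn₁ := n₁_mul_le (C := C) (R' := R') hR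
  have h20 : 20 * (C.s : ℤ) ≤ C.r := by exact_mod_cast C.twenty_mul_s_le_r
  have hR' : 27 * (R' : ℤ) ≤ C.s := by exact_mod_cast hR
  have hℓ' : (R' : ℤ) + ℓ₀ ≤ C.s := by exact_mod_cast hℓ
  obtain ⟨eα, eβ, eW⟩ := core_AT (C := C) (R' := R') hR (i := 2 * n₁ C) (m := n₁ C) (by omega) le_rfl
  obtain ⟨eα', eβ', eW'⟩ := core_B (C := C) (R' := R') (i := 2 * n₁ C + 1) (j := 1) rfl le_rfl
  have hq : 2 * (C.s : ℤ) + (n₁ C : ℤ) * R' = q C R' := rfl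
  have hW : 3 * (C.r : ℤ) + (n₁ C : ℤ) * R' - (n₁ C : ℤ) * C.s = q C R' := by unfold q; linarith
  rw [eα, eβ, eW, hq, hW] at hv
  have hnn : (0 : ℤ) ≤ (n₁ C : ℤ) * R' := by positivity
  have hq0 : 0 ≤ q C R' := by unfold q; positivity
  have hq1 : 3 * q C R' + C.s + 2 * R' ≤ 5 * C.r := by unfold q; linarith
  obtain ⟨ℓ, hℓ0, -, -, hsq, τ, -, hface⟩ := route_start hσ c (q := q C R') (q' := q C R') (s := C.s) (w₁ := w₁ C R')
    (ρ := 5 * C.r) (R' := R') (ℓ₀ := ℓ₀) hℓ' (by unfold w₁; linarith) (by linarith) hq1 hv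
  refine ⟨ℓ, hℓ0, ?_, a, τ, ?_⟩
  · rw [region_A le_rfl]
    exact hsq.trans (sBox_mono hσ c le_rfl (by linarith) le_rfl)
  · rw [core, eα', eβ', eW']
    convert hface using 2 <;> push_cast <;> ring

/-- Routes of the advance steps `i = 2n₁ + j`, `1 ≤ j ≤ nB`. [cite: KozmaNitzan2024, §4 Lemma 11 (pp. 22–23)] -/
theorem core_route_B {i j : ℕ} (hij : i = 2 * n₁ C + j) (hj : 1 ≤ j) (hjB : j ≤ nB C) {v : Site 2}
    (hv : v ∈ sBox a σ c (coreα C R' i - R') (coreβ C R' i + R') (coreW C R' i + R')) :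
    ∃ ℓ : ℕ, ℓ₀ ≤ ℓ ∧ shiftF v (box 2 ℓ) ⊆ region C R' a σ c i ∧
      ∃ (a' : Fin 2) (τ : Fin 2 → ℤˣ), shiftF v (orthantFace a' τ ℓ) ⊆ core C R' a σ c (i + 1) := by
  have h3r := three_r_eq (C := C) (R' := R') hR
  have hn₁ := n₁_mul_le (C := C) (R' := R') hR
  have hnB := nB_mul_le (C := C) (R' := R') hR
  have h20 : 20 * (C.s : ℤ) ≤ C.r := by exact_mod_cast C.twenty_mul_s_le_r
  have hR' : 27 * (R' : ℤ) ≤ C.s := by exact_mod_cast hR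
  have hℓ' : (R' : ℤ) + ℓ₀ ≤ C.s := by exact_mod_cast hℓ
  obtain ⟨eα, eβ, eW⟩ := core_B (C := C) (R' := R') hij hj
  obtain ⟨eα', eβ', eW'⟩ := core_B (C := C) (R' := R') (i := i + 1) (j := j + 1) (by omega) (by omega)
  have hjR : ((j : ℤ) - 1) * R' ≤ (nB C : ℤ) * R' :=
    mul_le_mul_of_nonneg_right (by linarith [(by exact_mod_cast hjB : (j : ℤ) ≤ nB C)]) (by positivity)
  have hjR0 : 0 ≤ ((j : ℤ) - 1) * R' := mul_nonneg (by linarith [(by exact_mod_cast hj : (1 : ℤ) ≤ j)]) (by positivity)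
  have hnn : (0 : ℤ) ≤ (n₁ C : ℤ) * R' := by positivity
  have hq0 : 0 ≤ q C R' := by unfold q; positivity
  rw [eα, eβ, eW] at hv
  obtain ⟨ℓ, hℓ0, -, -, hsq, τ, -, hface⟩ := route_advance hσ c (L := q C R' + (j : ℤ) * C.s) (s := C.s)
    (w := w₁ C R' + ((j : ℤ) - 1) * R') (ρ := 2 * C.r) (R' := R') (ℓ₀ := ℓ₀) hℓ' (by linarith) (by unfold w₁; linarith)
    (by unfold w₁ q; linarith) hv
  refine ⟨ℓ, hℓ0, by rw [region_B hij hj]; exact hsq, a, τ, ?_⟩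
  rw [core, eα', eβ', eW']
  convert hface using 2 <;> push_cast <;> ring

/-- **ROUTES.**  For every step `i ≤ nLast` and every `v` in the `R'`-enlargement of `core i` there is a scale `ℓ ≥ ℓ₀` with the square
`v + Λ_ℓ ⊆ region i` and a quarter-face `v + orthantFace a' τ ℓ ⊆ core (i+1)`. [cite: KozmaNitzan2024, §4 Lemmas 11–12] -/
theorem core_route {i : ℕ} (hi : i ≤ nLast C) {v : Site 2}
    (hv : v ∈ sBox a σ c (coreα C R' i - R') (coreβ C R' i + R') (coreW C R' i + R')) :
    ∃ ℓ : ℕ, ℓ₀ ≤ ℓ ∧ shiftF v (box 2 ℓ) ⊆ region C R' a σ c i ∧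
      ∃ (a' : Fin 2) (τ : Fin 2 → ℤˣ), shiftF v (orthantFace a' τ ℓ) ⊆ core C R' a σ c (i + 1) := by
  by_cases h1 : i < n₁ C
  · exact core_route_AL hσ c hR hℓ h1 hv
  by_cases h2 : i < 2 * n₁ C
  · exact core_route_AT hσ c hR hℓ (by omega) h2 hv
  by_cases h3 : i = 2 * n₁ C
  · subst h3; exact core_route_start hσ c hR hℓ hv
  · exact core_route_B hσ c hR hℓ (j := i - 2 * n₁ C) (by omega) (by omega) (by unfold nLast at hi; omega) hv

end Route

end ChainPlanar

end Transplant

end Summit.CriticalPhenomena.PercolationContinuityZ3.Theorems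

end
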